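import Summits.CriticalPhenomena.PercolationContinuityZ3.Theorems.PercNearOneGluingNoHeavyLowerTailSahiGridPatternLiteralTwoAbsorbCore
import Summits.CriticalPhenomena.PercolationContinuityZ3.Theorems.PercNearOneGluingNoHeavyLowerTailSahiGridPatternTwoOrthantLiteral
import Summits.CriticalPhenomena.PercolationContinuityZ3.Theorems.PercNearOneGluingNoHeavyLowerTailSahiGridPatternTwoOrthantGeneral

/-!
# `NoHeavyLowerTail` (crux stmt-CriticalPhenomena-4575), Sahi programme P1: **DIAGONAL CERTIFICATES — transfer, bases, and the
# threshold-1 literal step** (tools for the inductive star theorem)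

Support file (Sahi cell, seat `prim-sahi-p1`, generation 22; `--supports stmt-CriticalPhenomena-4575`).  Pure proofs, no definitions,
no `sorry`, standard axioms.  Vocabulary of `…SahiGridPattern{CellForm,DiagCert,PairCert,LiteralTwoAbsorb}`.

A DIAGONAL CERTIFICATE of an up-set `U ⊆ [3]^K` is `c : [3]^K → ℤ` with `c ≥ 0`, (T) `Σ_W c ≤ Σ_W λ_U` and (N) `Θ_U(A×A') ≤ Σ_{A∩A'} c`
(all up-sets; `…DiagCert`: it makes `U × [3]^m` a good first slot of the pattern functional in every dimension).  THIS FILE: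
* `diagCert_transfer`: certificates move along any re-indexing of the axes `e : Fin K' ≃ Fin K` (`λ`, `Θ`, `ν` are invariant);
* base certificates: `diagCert_empty` (`U = ∅`, `c = 0`), `diagCert_orthant` (`U = ↑p` an orthant, `c = 2^K·1_U`: condition (N) IS the
  Harris-reduced Conjecture P `sStarD_principal_ge_harris`, (T) is coefficientwise Harris `diagCert_T_of_trivial`);
* `litOneAbsorb_cert`: the THRESHOLD-1 LITERAL STEP — for ANY up-set `U' ⊆ [3]^k`, `{ξ ≥ 1} × [3]^k ∪ [3] × U'` has the pair certificate
  (`…PairCert`; (N) by `literalUnion_hS` of `…TwoOrthantLiteral`), no inner certificate needed;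
* `litTwoAbsorb_cert`: the threshold-2 step of `…LiteralTwoAbsorb{,Core}` repackaged in the same shape (certificate in, certificate out).
The induction over the literal axes is in `…SahiGridPatternStarLiteral`. [this work]
-/

namespace Summit.CriticalPhenomena.PercolationContinuityZ3.Theorems.SahiGridPattern

open Finset SahiGrid3
open scoped BigOperators

/-! ### Transfer of certificates along a re-indexing of the axes -/

section transfer
variable {d d' : ℕ}

/-- Total distinctness is invariant under re-indexing the axes. [this work] -/
theorem totDist_comp_equiv (e : Fin d' ≃ Fin d) (p q : Pd d) : TotDist (p ∘ e) (q ∘ e) = TotDist p q := by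
  rw [Bool.eq_iff_iff, totDist_iff, totDist_iff]
  constructor
  · intro h a; have := h (e.symm a); simpa using this
  · intro h a; exact h (e a)

/-- The third point commutes with re-indexing. [this work] -/
theorem thirdPt_comp_equiv (e : Fin d' ≃ Fin d) (p q : Pd d) : thirdPt (p ∘ e) (q ∘ e) = (thirdPt p q) ∘ e := by
  funext a; rfl

/-- Indicators under re-indexing. [this work] -/
theorem ind_comp_equiv (e : Fin d' ≃ Fin d) {U : Finset (Pd d')} {U' : Finset (Pd d)} (hU : ∀ p : Pd d, p ∈ U' ↔ (p ∘ e) ∈ U)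
    (q : Pd d) : ind U' q = ind U (q ∘ e) := by
  unfold ind
  by_cases h : q ∈ U'
  · rw [if_pos h, if_pos ((hU q).1 h)]
  · rw [if_neg h, if_neg (fun h' => h ((hU q).2 h'))]

/-- `ν` under re-indexing. [this work] -/
theorem nuCount_comp_equiv (e : Fin d' ≃ Fin d) {U : Finset (Pd d')} {U' : Finset (Pd d)} (hU : ∀ p : Pd d, p ∈ U' ↔ (p ∘ e) ∈ U)
    (q : Pd d) : nuCount U' q = nuCount U (q ∘ e) := by
  unfold nuCount
  let E : Pd d ≃ Pd d' := Equiv.arrowCongr e.symm (Equiv.refl (Fin 3))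
  have hE : ∀ p : Pd d, E p = p ∘ e := by
    intro p; funext a
    simp only [E, Equiv.arrowCongr_apply, Equiv.symm_symm, Equiv.coe_refl, Function.comp_apply, id_eq]
  have hEs : ∀ p' : Pd d', (E.symm p') ∘ e = p' := by
    intro p'; have := hE (E.symm p'); rw [Equiv.apply_symm_apply] at this; exact this.symm
  have hset : (U.filter fun p' => TotDist p' (q ∘ e) = true) = (U'.filter fun p => TotDist p q = true).map E.toEmbedding := by
    ext p'
    rw [Finset.mem_map_equiv, Finset.mem_filter, Finset.mem_filter, hU, hEs]
    have ht : TotDist p' (q ∘ e) = TotDist (E.symm p') q := by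
      rw [← totDist_comp_equiv e (E.symm p') q, hEs]
    rw [ht]
  rw [hset, Finset.card_map]

/-- `λ_U` under re-indexing. [this work] -/
theorem lamU_comp_equiv (e : Fin d' ≃ Fin d) {U : Finset (Pd d')} {U' : Finset (Pd d)} (hU : ∀ p : Pd d, p ∈ U' ↔ (p ∘ e) ∈ U)
    (q : Pd d) : lamU U' q = lamU U (q ∘ e) := by
  have hd : d' = d := by simpa using Fintype.card_congr e
  subst hd
  unfold lamU
  rw [ind_comp_equiv e hU, nuCount_comp_equiv e hU]

/-- `Θ_U` under re-indexing. [this work] -/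
theorem thetaVal_comp_equiv (e : Fin d' ≃ Fin d) {U : Finset (Pd d')} {U' : Finset (Pd d)} (hU : ∀ p : Pd d, p ∈ U' ↔ (p ∘ e) ∈ U)
    (q r : Pd d) : thetaVal U' q r = thetaVal U (q ∘ e) (r ∘ e) := by
  unfold thetaVal
  rw [totDist_comp_equiv, thirdPt_comp_equiv, ind_comp_equiv e hU, ind_comp_equiv e hU, ind_comp_equiv e hU]

/-- **TRANSFER OF A DIAGONAL CERTIFICATE ALONG A RE-INDEXING OF THE AXES**: if `p ∈ U' ↔ p ∘ e ∈ U` for `e : Fin d' ≃ Fin d` and `c` is a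
diagonal certificate of `U ⊆ [3]^{d'}`, then `p ↦ c (p ∘ e)` is a diagonal certificate of `U' ⊆ [3]^d`. [this work] -/
theorem diagCert_transfer (e : Fin d' ≃ Fin d) {U : Finset (Pd d')} {U' : Finset (Pd d)} (hU : ∀ p : Pd d, p ∈ U' ↔ (p ∘ e) ∈ U)
    (c : Pd d' → ℤ) (hc : ∀ q, 0 ≤ c q)
    (hT : ∀ W : Finset (Pd d'), IsUpperSet (W : Set (Pd d')) → (∑ q ∈ W, c q) ≤ ∑ q ∈ W, lamU U q)
    (hN : ∀ A A' : Finset (Pd d'), IsUpperSet (A : Set (Pd d')) → IsUpperSet (A' : Set (Pd d')) →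
      (∑ q ∈ A, ∑ r ∈ A', thetaVal U q r) ≤ ∑ q ∈ A ∩ A', c q) :
    (∀ p : Pd d, 0 ≤ c (p ∘ e)) ∧
    (∀ W : Finset (Pd d), IsUpperSet (W : Set (Pd d)) → (∑ p ∈ W, c (p ∘ e)) ≤ ∑ p ∈ W, lamU U' p) ∧
    (∀ A A' : Finset (Pd d), IsUpperSet (A : Set (Pd d)) → IsUpperSet (A' : Set (Pd d)) →
      (∑ q ∈ A, ∑ r ∈ A', thetaVal U' q r) ≤ ∑ p ∈ A ∩ A', c (p ∘ e)) := by
  let E : Pd d ≃ Pd d' := Equiv.arrowCongr e.symm (Equiv.refl (Fin 3))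
  have hE : ∀ p : Pd d, E p = p ∘ e := by
    intro p; funext a
    simp only [E, Equiv.arrowCongr_apply, Equiv.symm_symm, Equiv.coe_refl, Function.comp_apply, id_eq]
  have hmap : ∀ (S : Finset (Pd d)) (g : Pd d' → ℤ), (∑ p ∈ S, g (p ∘ e)) = ∑ q ∈ S.map E.toEmbedding, g q := by
    intro S g; rw [Finset.sum_map]
    exact Finset.sum_congr rfl fun p _ => by rw [Equiv.coe_toEmbedding, hE]
  refine ⟨fun p => hc _, fun W hW => ?_, fun A A' hA hA' => ?_⟩
  · rw [hmap W c]
    have h := hT (W.map E.toEmbedding) (isUpperSet_map_comp_equiv e hW)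
    refine le_trans h (le_of_eq ?_)
    rw [← hmap W (lamU U)]
    exact Finset.sum_congr rfl fun p _ => (lamU_comp_equiv e hU p).symm
  · have h := hN (A.map E.toEmbedding) (A'.map E.toEmbedding) (isUpperSet_map_comp_equiv e hA) (isUpperSet_map_comp_equiv e hA')
    rw [← Finset.map_inter, ← hmap (A ∩ A') c] at h
    refine le_trans (le_of_eq ?_) h
    rw [Finset.sum_map]
    refine Finset.sum_congr rfl fun q _ => ?_
    rw [Finset.sum_map]
    refine Finset.sum_congr rfl fun r _ => ?_
    simp only [Equiv.coe_toEmbedding, hE]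
    exact thetaVal_comp_equiv e hU q r

end transfer

/-! ### Base certificates: the empty set and an orthant -/

variable {k : ℕ}

/-- **The empty first slot has the certificate `0`.** [this work] -/
theorem diagCert_empty :
    (∀ q : Pd k, (0:ℤ) ≤ (fun _ => (0:ℤ)) q) ∧
    (∀ W : Finset (Pd k), IsUpperSet (W : Set (Pd k)) → (∑ q ∈ W, (fun _ => (0:ℤ)) q) ≤ ∑ q ∈ W, lamU (∅ : Finset (Pd k)) q) ∧
    (∀ A A' : Finset (Pd k), IsUpperSet (A : Set (Pd k)) → IsUpperSet (A' : Set (Pd k)) →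
      (∑ q ∈ A, ∑ r ∈ A', thetaVal (∅ : Finset (Pd k)) q r) ≤ ∑ q ∈ A ∩ A', (fun _ => (0:ℤ)) q) := by
  refine ⟨fun _ => le_rfl, fun W _ => ?_, fun A A' _ _ => ?_⟩
  · simp only [Finset.sum_const_zero]
    refine Finset.sum_nonneg fun q _ => ?_
    unfold lamU nuCount ind
    simp
  · simp only [Finset.sum_const_zero]
    refine le_of_eq (Finset.sum_eq_zero fun q _ => Finset.sum_eq_zero fun r _ => ?_)
    unfold thetaVal ind
    simp

/-- **An orthant `↑p = {x : p ≤ x}` has the certificate `2^k·1_{↑p}`**: (T) is coefficientwise Harris (`diagCert_T_of_trivial`) and (N) is the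
Harris-reduced Conjecture P (`sStarD_principal_ge_harris`). [this work] -/
theorem diagCert_orthant (p : Pd k) :
    (∀ q : Pd k, (0:ℤ) ≤ (2:ℤ) ^ k * ind (univ.filter fun x : Pd k => ∀ a, p a ≤ x a) q) ∧
    (∀ W : Finset (Pd k), IsUpperSet (W : Set (Pd k)) →
      (∑ q ∈ W, (2:ℤ) ^ k * ind (univ.filter fun x : Pd k => ∀ a, p a ≤ x a) q)
        ≤ ∑ q ∈ W, lamU (univ.filter fun x : Pd k => ∀ a, p a ≤ x a) q) ∧
    (∀ A A' : Finset (Pd k), IsUpperSet (A : Set (Pd k)) → IsUpperSet (A' : Set (Pd k)) →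
      (∑ q ∈ A, ∑ r ∈ A', thetaVal (univ.filter fun x : Pd k => ∀ a, p a ≤ x a) q r)
        ≤ ∑ q ∈ A ∩ A', (2:ℤ) ^ k * ind (univ.filter fun x : Pd k => ∀ a, p a ≤ x a) q) := by
  set X : Finset (Pd k) := univ.filter fun x : Pd k => ∀ a, p a ≤ x a with hX
  have hXup : IsUpperSet (X : Set (Pd k)) := by rw [hX]; exact isUpperSet_filter_le p
  refine ⟨fun q => mul_nonneg (pow_nonneg (by norm_num) k) (ind_nonneg' X q), fun W hW => diagCert_T_of_trivial X W hXup hW,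
    fun A A' hA hA' => ?_⟩
  have h := sStarD_principal_ge_harris k p A A' hA hA'
  rw [← hX] at h
  have h1 := sStarD_eq_sum_lamU_sub_sum_thetaVal X A A'
  -- `Σ_{A∩A'} λ_X = 2·2^k Σ 1_X 1_A 1_A' − Σ_x Σ_y 1_X(x) 1_A(y) 1_A'(y) [x δ̸ y]`
  have h2 : (∑ q ∈ A ∩ A', lamU X q) = 2 * 2 ^ k * (∑ x, ind X x * ind A x * ind A' x)
      - ∑ x, ∑ y, ind X x * ind A y * ind A' y * (if TotDist x y = true then (1:ℤ) else 0) := by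
    rw [sum_mem_eq_sum_ind_mul]
    rw [show (∑ q, ind (A ∩ A') q * lamU X q) = (∑ q, 2 * 2 ^ k * (ind X q * ind A q * ind A' q))
        - ∑ q, ind A q * ind A' q * (nuCount X q : ℤ) from by
      rw [← Finset.sum_sub_distrib]
      exact Finset.sum_congr rfl fun q _ => by unfold lamU; rw [ind_inter_eq_mul]; ring]
    rw [← Finset.mul_sum]
    congr 1
    rw [Finset.sum_comm]
    refine Finset.sum_congr rfl fun y _ => ?_
    rw [nuCount_eq_sum_ind, Finset.mul_sum]
    exact Finset.sum_congr rfl fun x _ => by ring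
  have h3 : (∑ q ∈ A ∩ A', (2:ℤ) ^ k * ind X q) = 2 ^ k * ∑ x, ind X x * ind A x * ind A' x := by
    rw [sum_mem_eq_sum_ind_mul, Finset.mul_sum]
    refine Finset.sum_congr rfl fun x _ => ?_
    rw [ind_inter_eq_mul]; ring
  rw [h3]
  linarith

/-! ### The two literal steps in certificate form -/

/-- **THE THRESHOLD-1 LITERAL STEP** (every `k`, ANY up-set `U' ⊆ [3]^k`, no inner certificate needed): with `X = {ξ ≥ 1} × [3]^k`
(trace `↑a`, `a = 1 ∈ [3]^1`) and `Y = [3] × U'`, the pair certificate of `X ∪ Y` (`X` pays) is a diagonal certificate of `X ∪ Y`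
(`pairCert_nonneg`, `pairCert_T`, and (N) by `literalUnion_hS`). [this work] -/
theorem litOneAbsorb_cert (a : Pd 1) (ha : ∀ i, a i = 1) {U' : Finset (Pd k)} (hU' : IsUpperSet (U' : Set (Pd k)))
    {X Y : Finset (Pd (1 + k))} (hX : ∀ ξ z, glue ξ z ∈ X ↔ ξ ∈ (univ.filter fun x : Pd 1 => ∀ i, a i ≤ x i))
    (hY : ∀ ξ z, glue ξ z ∈ Y ↔ z ∈ U') :
    (∀ x : Pd (1 + k), 0 ≤ (2:ℤ) ^ (1 + k) * (ind X x + ind Y x) - ind X x * ((nuCount (X ∪ Y) x : ℤ) - nuCount X x)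
        - ind X x * ind Y x * (nuCount X x : ℤ)) ∧
    (∀ W : Finset (Pd (1 + k)), IsUpperSet (W : Set (Pd (1 + k))) →
      (∑ x ∈ W, ((2:ℤ) ^ (1 + k) * (ind X x + ind Y x) - ind X x * ((nuCount (X ∪ Y) x : ℤ) - nuCount X x)
        - ind X x * ind Y x * (nuCount X x : ℤ))) ≤ ∑ x ∈ W, lamU (X ∪ Y) x) ∧
    (∀ A A' : Finset (Pd (1 + k)), IsUpperSet (A : Set (Pd (1 + k))) → IsUpperSet (A' : Set (Pd (1 + k))) →
      (∑ q ∈ A, ∑ r ∈ A', thetaVal (X ∪ Y) q r) ≤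
        ∑ x ∈ A ∩ A', ((2:ℤ) ^ (1 + k) * (ind X x + ind Y x) - ind X x * ((nuCount (X ∪ Y) x : ℤ) - nuCount X x)
          - ind X x * ind Y x * (nuCount X x : ℤ))) :=
  ⟨fun x => pairCert_nonneg X Y x, fun W hW => pairCert_T hX hY (isUpperSet_filter_le a) hU' W hW,
    pairCert_N_of_sStarD_ge hX hY (literalUnion_hS a ha U' hU' hX hY)⟩

/-- **THE THRESHOLD-2 LITERAL STEP** (every `k`): with `X = {ξ = 2} × [3]^k` (trace `↑ℓ`, `ℓ 0 = 2`), `Y = [3] × U'`, and a diagonal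
certificate `c'` of the up-set `U'`, the vector `d_pair + [ξ ≠ 2](c' − 2^k 1_{U'})` is a diagonal certificate of `X ∪ Y`
(`litAbsorb_cert_nonneg`, `litAbsorb_cert_T`, `litAbsorb_cert_N`). [this work] -/
theorem litTwoAbsorb_cert (ℓ : Pd 1) (hℓ : ℓ 0 = 2) {U' : Finset (Pd k)} (hU' : IsUpperSet (U' : Set (Pd k))) (c' : Pd k → ℤ)
    (hc' : ∀ z, 0 ≤ c' z)
    (hT' : ∀ W : Finset (Pd k), IsUpperSet (W : Set (Pd k)) → (∑ z ∈ W, c' z) ≤ ∑ z ∈ W, lamU U' z)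
    (hN' : ∀ P Q : Finset (Pd k), IsUpperSet (P : Set (Pd k)) → IsUpperSet (Q : Set (Pd k)) →
      (∑ q ∈ P, ∑ r ∈ Q, thetaVal U' q r) ≤ ∑ z ∈ P ∩ Q, c' z)
    {X Y : Finset (Pd (1 + k))} (hX : ∀ ξ z, glue ξ z ∈ X ↔ ξ ∈ (univ.filter fun y : Pd 1 => ∀ j, ℓ j ≤ y j))
    (hY : ∀ ξ z, glue ξ z ∈ Y ↔ z ∈ U') :
    (∀ x : Pd (1 + k), 0 ≤ (2:ℤ) ^ (1 + k) * (ind X x + ind Y x) - ind X x * ((nuCount (X ∪ Y) x : ℤ) - nuCount X x)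
        - ind X x * ind Y x * (nuCount X x : ℤ)
        + (1 - ind X x) * (c' (cellOf x) - 2 ^ k * ind U' (cellOf x))) ∧
    (∀ W : Finset (Pd (1 + k)), IsUpperSet (W : Set (Pd (1 + k))) →
      (∑ x ∈ W, ((2:ℤ) ^ (1 + k) * (ind X x + ind Y x) - ind X x * ((nuCount (X ∪ Y) x : ℤ) - nuCount X x)
        - ind X x * ind Y x * (nuCount X x : ℤ)
        + (1 - ind X x) * (c' (cellOf x) - 2 ^ k * ind U' (cellOf x)))) ≤ ∑ x ∈ W, lamU (X ∪ Y) x) ∧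
    (∀ A A' : Finset (Pd (1 + k)), IsUpperSet (A : Set (Pd (1 + k))) → IsUpperSet (A' : Set (Pd (1 + k))) →
      (∑ q ∈ A, ∑ r ∈ A', thetaVal (X ∪ Y) q r) ≤
        ∑ x ∈ A ∩ A', ((2:ℤ) ^ (1 + k) * (ind X x + ind Y x) - ind X x * ((nuCount (X ∪ Y) x : ℤ) - nuCount X x)
          - ind X x * ind Y x * (nuCount X x : ℤ)
          + (1 - ind X x) * (c' (cellOf x) - 2 ^ k * ind U' (cellOf x)))) :=
  ⟨fun x => litAbsorb_cert_nonneg c' hc' hY x, fun W hW => litAbsorb_cert_T ℓ hℓ c' hT' hX hY W hW,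
    litAbsorb_cert_N ℓ hℓ hU' c' hc' hN' hX hY⟩

end Summit.CriticalPhenomena.PercolationContinuityZ3.Theorems.SahiGridPattern
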